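import Summits.ValiantsHypothesis.ValiantsHypothesis.Theorems.MonotoneRestorationOrbitRestorationQPTermBlocks
import HarnessLib

/-!
# `e₂` of the column Vandermondes: a matrix-symmetric `ΣΠΣ` family with sign-twisted many-term representation,
# restored by PAIRING (witness for the term-block criterion; ORBIT currency)

Route MonotoneRestoration, crux `OrbitRestorationQP` (stmt-ValiantsHypothesis-18293), line `depth-three-rung`, rung
`A_∞ = stub_sigmaPiSigmaValue`; namespace `Summit.ValiantsHypothesis.ValiantsHypothesis.Theorems.TermBlocks`.

The family.  `D_j := Π_{i<i'} (x_{ij} − x_{i'j})` (the Vandermonde of column `j` of the `n × n` matrix) and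

  `P_n := e₂(D_1, …, D_n) = Σ_{{j,j'}} D_j D_{j'}`  (sum over the 2-subsets of columns).

`P_n` is matrix-symmetric (`(σ, τ)` maps `D_j` to `sgn(σ) D_{τ j}`, and the two signs of a term cancel), it is given by a
depth-three representation with `C(n,2)` terms, each a product of `n(n−1)` forms `x_{ij} − x_{i'j}` — so the family lies in
the hypothesis class `PDClass 1` of `A_∞` — and it is OUTSIDE the landed strata of the residue bookkeeping: no term
`D_j D_{j'}` is matrix-symmetric (kind (S)); the row transpositions fix the term index `{j,j'}` and reverse factor LINES, and
an `Alt`-invariant orientation of the row pairs does not exist (`Alt_m` is `2`-transitive), so in every affine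
factorisation the factor multiset of a term has super-polynomially many diagonal translates (not kind (T)); the box
volume is exponential (not kind (B)); `P_n ∉ ℂ[r, c]` and `P_n` is not invariant under the permutations inside one column
(an odd one flips every term through that column) nor inside one row.  What restores it is PAIRING: the block
`w_{{i,i'},{j,j'}} := (x_{ij} − x_{i'j})(x_{ij'} − x_{i'j'})` does not depend on the orientation of `{i, i'}`, the blocks
are honestly permuted by the diagonal action, `D_j D_{j'} = Π_{{i,i'}} w_{{i,i'},{j,j'}}`, and the term-block criterion
`TermBlocks.qpOrbitRestorable_of_termBlocks` applies with `k = 4`.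

* `prod_powersetCard_two` — `Π_{A ∈ 2-subsets} g A = Π_i Π_{i' > i} g {i, i'}` (bookkeeping);
* `sum_pair_orient` — the oriented difference `Σ_{a ∈ {a₁,a₂}} ε_A(a) x_{aj}` (`ε = +1` on the minimum, `−1` else) is
  `± (x_{a₁ j} − x_{a₂ j})`;
* `qpOrbitRestorable_e2_columnVandermondes` — **`P_n` is `QPOrbitRestorable 9 n` for every `n`** (uniform constant);
* `isMatrixSymmetric_e2_columnVandermondes` — the family is matrix-symmetric (hypothesis of the crux / of `A_∞`).

Honest label: one explicit matrix-symmetric depth-three family outside the landed strata, restored by a new mechanism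
(pairing of twisted factors across the columns of a term); a test instance for the wild residue, not a dent in it.  The stub,
the crux and VP ≠ VNP are not moved.  Everything is proved. [folklore]

## References
* A. Dawar, G. Wilsenach, *Symmetric arithmetic circuits*, ToC 21 (2025), §3.3, Def. 6.1. [DawarWilsenach2025]
-/

noncomputable section

open scoped Classical Pointwise

-- `Summit.ValiantsHypothesis.ValiantsHypothesis.…` is the tree's single-conjunct layout (Sub = Summit).
set_option linter.dupNamespace false

namespace Summit.ValiantsHypothesis.ValiantsHypothesis.Theorems

namespace TermBlocks

open MvPolynomial Equiv Finset Literature.Computability.AlgebraicComplexity OrbitRestorationQPDepthThreeRung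

variable {n : ℕ}

/-- **Products over 2-subsets are products over ordered pairs `i < i'`.** [folklore] -/
theorem prod_powersetCard_two {R : Type*} [CommMonoid R] (g : Finset (Fin n) → R) :
    ∏ A ∈ (univ : Finset (Fin n)).powersetCard 2, g A = ∏ i : Fin n, ∏ i' ∈ Ioi i, g {i, i'} := by
  set r : Finset (Fin n × Fin n) := univ.filter fun p => p.1 < p.2 with hr
  have hmem : ∀ p : Fin n × Fin n, p ∈ r ↔ p.1 ∈ (univ : Finset (Fin n)) ∧ p.2 ∈ Ioi p.1 := fun p => by
    simp only [hr, mem_filter, mem_univ, true_and, mem_Ioi]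
  rw [← Finset.prod_finset_product' r univ (fun i => Ioi i) hmem (f := fun i i' => g {i, i'})]
  symm
  refine Finset.prod_bij (fun p _ => ({p.1, p.2} : Finset (Fin n))) (fun p hp => ?_) (fun p hp q hq hpq => ?_)
    (fun A hA => ?_) (fun p hp => rfl)
  · have hlt : p.1 < p.2 := (mem_filter.1 hp).2
    exact mem_powersetCard.2 ⟨subset_univ _, card_pair (ne_of_lt hlt)⟩
  · have hp' : p.1 < p.2 := (mem_filter.1 hp).2
    have hq' : q.1 < q.2 := (mem_filter.1 hq).2
    have h1 : p.1 ∈ ({q.1, q.2} : Finset (Fin n)) := by rw [← hpq]; simp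
    have h2 : p.2 ∈ ({q.1, q.2} : Finset (Fin n)) := by rw [← hpq]; simp
    have h3 : q.1 ∈ ({p.1, p.2} : Finset (Fin n)) := by rw [hpq]; simp
    simp only [mem_insert, mem_singleton] at h1 h2 h3
    rcases h1 with h1 | h1
    · refine Prod.ext h1 ?_
      rcases h2 with h2 | h2
      · rw [h1, h2] at hp'; exact absurd hp' (lt_irrefl _)
      · exact h2
    · exfalso
      rcases h3 with h3 | h3
      · rw [h3, h1] at hq'; exact lt_irrefl _ hq'
      · rw [h1, ← h3] at hp'; exact lt_asymm hp' hq'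
  · obtain ⟨-, hA2⟩ := mem_powersetCard.1 hA
    obtain ⟨x, y, hxy, rfl⟩ := card_eq_two.1 hA2
    rcases lt_or_gt_of_ne hxy with h | h
    · exact ⟨(x, y), mem_filter.2 ⟨mem_univ _, h⟩, rfl⟩
    · exact ⟨(y, x), mem_filter.2 ⟨mem_univ _, h⟩, pair_comm y x⟩

/-- **The oriented difference of a pair.**  For `a₁ ≠ a₂`,
`Σ_{a ∈ {a₁,a₂}} ε(a) · x_{a j} = ± (x_{a₁ j} − x_{a₂ j})` with `ε(a) = 1` if `a` is the minimum of the pair and `−1`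
otherwise, the sign being `+` iff `a₁ < a₂`. [folklore] -/
theorem sum_pair_orient {a₁ a₂ : Fin n} (h : a₁ ≠ a₂) (j : Fin n) :
    (∑ a ∈ ({a₁, a₂} : Finset (Fin n)),
        C (if ∀ a' ∈ ({a₁, a₂} : Finset (Fin n)), a ≤ a' then (1 : ℂ) else -1) * X (a, j) :
        MvPolynomial (Fin n × Fin n) ℂ) =
      C (if a₁ < a₂ then (1 : ℂ) else -1) * (X (a₁, j) - X (a₂, j)) := by
  rw [sum_pair h]
  have h1 : (∀ a' ∈ ({a₁, a₂} : Finset (Fin n)), a₁ ≤ a') ↔ a₁ ≤ a₂ := by simp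
  have h2 : (∀ a' ∈ ({a₁, a₂} : Finset (Fin n)), a₂ ≤ a') ↔ a₂ ≤ a₁ := by simp
  simp only [h1, h2]
  rcases lt_or_gt_of_ne h with hlt | hlt
  · rw [if_pos hlt.le, if_neg (not_le.2 hlt), if_pos hlt, map_neg, map_one]; ring
  · rw [if_neg (not_le.2 hlt), if_pos hlt.le, if_neg (not_lt.2 hlt.le), map_neg, map_one]; ring

/-- **`e₂` OF THE COLUMN VANDERMONDES IS ORBIT-RESTORABLE, UNIFORMLY:** for every `n`,
`Σ_{{j,j'}} D_j D_{j'}` with `D_j = Π_{i<i'} (x_{ij} − x_{i'j})` is `QPOrbitRestorable 9 n` — by the term-block criterion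
with terms the 2-sets of columns, blocks the pairs (2-set of rows, 2-set of columns) and block multisets
`{± (x_{ij} − x_{i'j}), ± (x_{ij'} − x_{i'j'})}` (oriented by the minimum of the row pair), whose products are honestly
permuted. [folklore; cite: DawarWilsenach2025, §3.3 and Def. 6.1] -/
theorem qpOrbitRestorable_e2_columnVandermondes (n : ℕ) :
    QPOrbitRestorable 9 n
      (∑ T ∈ (univ : Finset (Fin n)).powersetCard 2,
        ∏ j ∈ T, ∏ i : Fin n, ∏ i' ∈ Ioi i, (X (i, j) - X (i', j) : MvPolynomial (Fin n × Fin n) ℂ)) := by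
  -- the data of the term-block system
  set ε : Finset (Fin n) → Fin n → ℂ := fun A a => if ∀ a' ∈ A, a ≤ a' then (1 : ℂ) else -1 with hε
  set d : Finset (Fin n) → Fin n → MvPolynomial (Fin n × Fin n) ℂ :=
    fun A j => ∑ a ∈ A, C (ε A a) * X (a, j) with hd
  set M : Finset (Fin n) × Finset (Fin n) → Multiset (MvPolynomial (Fin n × Fin n) ℂ) :=
    fun b => if b.1.card = 2 ∧ b.2.card = 2 then b.2.val.map (d b.1) else 0 with hM
  set a : Finset (Fin n) → ℂ := fun T => if T.card = 2 then 1 else 0 with ha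
  -- the sign rule for the oriented differences
  have hsgn : ∀ (σ : Perm (Fin n)) (A : Finset (Fin n)), A.card = 2 → ∃ s : ℂ, s * s = 1 ∧
      ∀ j : Fin n, ren σ (d A j) = C s * d (σ • A) (σ j) := by
    intro σ A hA
    obtain ⟨a₁, a₂, h12, rfl⟩ := card_eq_two.1 hA
    have hσ12 : σ a₁ ≠ σ a₂ := fun h => h12 (σ.injective h)
    have hσA : σ • ({a₁, a₂} : Finset (Fin n)) = {σ a₁, σ a₂} := by
      rw [smul_finset_insert, smul_finset_singleton]; rfl
    refine ⟨(if a₁ < a₂ then (1 : ℂ) else -1) * (if σ a₁ < σ a₂ then (1 : ℂ) else -1), ?_, fun j => ?_⟩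
    · split_ifs <;> norm_num
    · have e1 : d {a₁, a₂} j = C (if a₁ < a₂ then (1 : ℂ) else -1) * (X (a₁, j) - X (a₂, j)) :=
        sum_pair_orient h12 j
      have e2 : d (σ • ({a₁, a₂} : Finset (Fin n))) (σ j) =
          C (if σ a₁ < σ a₂ then (1 : ℂ) else -1) * (X (σ a₁, σ j) - X (σ a₂, σ j)) := by
        rw [hσA]; exact sum_pair_orient hσ12 (σ j)
      rw [e1, e2, map_mul, ren_C, map_sub, ren_X, ren_X]
      have hp1 : σ • ((a₁, j) : Fin n × Fin n) = (σ a₁, σ j) := rfl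
      have hp2 : σ • ((a₂, j) : Fin n × Fin n) = (σ a₂, σ j) := rfl
      rw [hp1, hp2, ← mul_assoc, ← map_mul]
      congr 2
      split_ifs <;> norm_num
  -- forms are fixed by the pointwise stabiliser of the row pair and the column
  have hfix : ∀ (σ : Perm (Fin n)) (A : Finset (Fin n)) (j : Fin n), (∀ x ∈ A, σ x = x) → σ j = j →
      ren σ (d A j) = d A j := by
    intro σ A j hA hj
    rw [hd]
    simp only [map_sum, map_mul, ren_C, ren_X]
    refine sum_congr rfl fun x hx => ?_
    have hp : σ • ((x, j) : Fin n × Fin n) = (σ x, σ j) := rfl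
    rw [hp, hA x hx, hj]
  have main := TermBlocks.qpOrbitRestorable_of_termBlocks (n := n) (k := 4)
    (B := Finset (Fin n) × Finset (Fin n)) (T := Finset (Fin n)) Prod.snd (fun σ b => rfl) M a
    (fun σ T => by simp only [ha, card_smul_finset]) ?_ ?_ ?_ ?_ ?_
  rotate_left
  · -- (hAff) the forms are affine
    rintro ⟨A, T⟩ q hq
    simp only [hM] at hq
    split_ifs at hq with h
    · obtain ⟨j, -, rfl⟩ := Multiset.mem_map.1 hq
      rw [hd]
      refine totalDegree_finsetSum_le fun x _ => ?_
      calc (C (ε A x) * X (x, j)).totalDegree ≤ (C (ε A x)).totalDegree + (X (x, j)).totalDegree :=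
            totalDegree_mul _ _
        _ ≤ 0 + 1 := Nat.add_le_add (by rw [totalDegree_C]) (totalDegree_X _).le
        _ = 1 := rfl
    · simp at hq
  · -- (hSupp) forms are fixed by the pointwise stabiliser of `A ∪ {j}`
    rintro ⟨A, T⟩ q hq
    simp only [hM] at hq
    split_ifs at hq with h
    · obtain ⟨j, hj, rfl⟩ := Multiset.mem_map.1 hq
      refine ⟨insert j A, ?_, fun σ hσ => hfix σ A j (fun x hx => hσ x (mem_insert_of_mem hx))
        (hσ j (mem_insert_self j A))⟩
      exact (card_insert_le j A).trans (by obtain ⟨h1, -⟩ := h; omega)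
    · simp at hq
  · -- (hPerm) block multisets are fixed by the pointwise stabiliser of `A ∪ T`
    rintro ⟨A, T⟩
    by_cases h : A.card = 2 ∧ T.card = 2
    · refine ⟨A ∪ T, (card_union_le A T).trans (by obtain ⟨h1, h2⟩ := h; omega), fun σ hσ => ?_⟩
      simp only [hM, if_pos h, Multiset.map_map]
      refine Multiset.map_congr rfl fun j hj => ?_
      exact hfix σ A j (fun x hx => hσ x (mem_union_left T hx)) (hσ j (mem_union_right A (mem_def.2 hj)))
    · refine ⟨∅, by simp, fun σ _ => ?_⟩
      simp only [hM, if_neg h, Multiset.map_zero]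
  · -- (hEqv) block products are honestly permuted: the two signs of a block cancel
    rintro σ ⟨A, T⟩
    have hcardA : (σ • A).card = A.card := card_smul_finset σ A
    have hcardT : (σ • T).card = T.card := card_smul_finset σ T
    show ren σ (M (A, T)).prod = (M (σ • A, σ • T)).prod
    by_cases h : A.card = 2 ∧ T.card = 2
    · have h' : (σ • A).card = 2 ∧ (σ • T).card = 2 := by rw [hcardA, hcardT]; exact h
      simp only [hM, if_pos h, if_pos h']
      obtain ⟨s, hs, hsj⟩ := hsgn σ A h.1
      rw [← prod_eq_multiset_prod, ← prod_eq_multiset_prod, map_prod]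
      simp only [hsj]
      rw [prod_mul_distrib, prod_const, h.2, ← map_pow, sq, hs, map_one, one_mul,
        show σ • T = T.image σ by ext x; simp only [mem_smul_finset, mem_image, Perm.smul_def],
        prod_image fun x _ y _ hxy => σ.injective hxy]
    · have h' : ¬((σ • A).card = 2 ∧ (σ • T).card = 2) := by rw [hcardA, hcardT]; exact h
      simp only [hM, if_neg h, if_neg h', Multiset.prod_zero, map_one]
  · -- (hT) a term with a non-empty block is a 2-set of columns, fixed by its pointwise stabiliser
    rintro T ⟨⟨A, T'⟩, hkey, hne⟩
    simp only at hkey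
    subst hkey
    have hT2 : T'.card = 2 := by
      by_contra hc
      apply hne
      simp only [hM]
      rw [if_neg fun h => hc h.2]
    refine ⟨T', by omega, fun σ hσ => ?_⟩
    ext x
    simp only [mem_smul_finset]
    constructor
    · rintro ⟨y, hy, rfl⟩
      show σ y ∈ T'
      rw [hσ y hy]; exact hy
    · intro hx; exact ⟨x, hx, hσ x hx⟩
  -- rewriting the conclusion of the criterion into `Σ_{T} Π_{j ∈ T} D_j`
  have hterm : ∀ T : Finset (Fin n), T.card = 2 →
      ∏ b ∈ univ.filter (fun b : Finset (Fin n) × Finset (Fin n) => b.2 = T), (M b).prod =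
        ∏ j ∈ T, ∏ i : Fin n, ∏ i' ∈ Ioi i, (X (i, j) - X (i', j) : MvPolynomial (Fin n × Fin n) ℂ) := by
    intro T hT
    rw [prod_filter, Fintype.prod_prod_type]
    simp only [prod_ite_eq', mem_univ, if_true]
    have hblock : ∀ A : Finset (Fin n), (M (A, T)).prod = if A.card = 2 then ∏ j ∈ T, d A j else 1 := by
      intro A
      by_cases hA : A.card = 2
      · simp only [hM, if_pos (And.intro hA hT), if_pos hA]
        exact (prod_eq_multiset_prod _ _).symm
      · simp only [hM, if_neg fun h : A.card = 2 ∧ T.card = 2 => hA h.1, if_neg hA, Multiset.prod_zero]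
    simp only [hblock]
    rw [← prod_filter, show (univ : Finset (Finset (Fin n))).filter (fun A => A.card = 2) =
      (univ : Finset (Fin n)).powersetCard 2 by rw [powersetCard_eq_filter, powerset_univ], prod_comm]
    refine prod_congr rfl fun j _ => ?_
    rw [prod_powersetCard_two]
    refine prod_congr rfl fun i _ => prod_congr rfl fun i' hi' => ?_
    have hlt : i < i' := mem_Ioi.1 hi'
    rw [show d {i, i'} j = C (if i < i' then (1 : ℂ) else -1) * (X (i, j) - X (i', j)) from
      sum_pair_orient (ne_of_lt hlt) j, if_pos hlt, map_one, one_mul]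
  have hsum : (∑ T : Finset (Fin n), C (a T) *
        ∏ b ∈ univ.filter (fun b : Finset (Fin n) × Finset (Fin n) => b.2 = T), (M b).prod) =
      ∑ T ∈ (univ : Finset (Fin n)).powersetCard 2,
        ∏ j ∈ T, ∏ i : Fin n, ∏ i' ∈ Ioi i, (X (i, j) - X (i', j) : MvPolynomial (Fin n × Fin n) ℂ) := by
    rw [powersetCard_eq_filter, powerset_univ, sum_filter]
    refine sum_congr rfl fun T _ => ?_
    by_cases hT : T.card = 2
    · rw [if_pos hT, ha]; simp only [if_pos hT, map_one, one_mul]; exact hterm T hT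
    · rw [if_neg hT, ha]; simp only [if_neg hT, map_zero, zero_mul]
  rw [← hsum]
  convert main

/-- **The family `e₂(D_1, …, D_n)` is matrix-symmetric** (independent row and column permutations): the
hypothesis of the crux `OrbitRestorationQP` and of the rung `A_∞`. [folklore] -/
theorem isMatrixSymmetric_e2_columnVandermondes :
    IsMatrixSymmetric fun n => ∑ T ∈ (univ : Finset (Fin n)).powersetCard 2,
      ∏ j ∈ T, ∏ i : Fin n, ∏ i' ∈ Ioi i, (X (i, j) - X (i', j) : MvPolynomial (Fin n × Fin n) ℂ) := by
  intro n σ τ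
  set s : MvPolynomial (Fin n × Fin n) ℂ := ((Equiv.Perm.sign σ : ℤ) : MvPolynomial (Fin n × Fin n) ℂ) with hsdef
  have hs : s * s = 1 := by
    rw [hsdef, ← Int.cast_mul, ← Units.val_mul, Int.units_mul_self, Units.val_one, Int.cast_one]
  -- the column Vandermonde is alternating under row permutations and permuted by column permutations
  have hcol : ∀ j : Fin n, ∏ i : Fin n, ∏ i' ∈ Ioi i,
      (rename (fun p : Fin n × Fin n => (σ p.1, τ p.2)) (X (i, j) - X (i', j)) : MvPolynomial (Fin n × Fin n) ℂ) =
        s * ∏ i : Fin n, ∏ i' ∈ Ioi i, (X (i, τ j) - X (i', τ j)) := by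
    intro j
    simp only [map_sub, rename_X]
    exact Equiv.Perm.prod_Ioi_comp_eq_sign_mul_prod σ
      (f := fun i i' => (X (i, τ j) - X (i', τ j) : MvPolynomial (Fin n × Fin n) ℂ)) fun i i' => (neg_sub _ _).symm
  simp only [map_sum, map_prod, hcol]
  refine Finset.sum_equiv (MulAction.toPerm τ : Perm (Finset (Fin n))) (fun T => ?_) (fun T hT => ?_)
  · simp only [MulAction.toPerm_apply, mem_powersetCard, card_smul_finset, subset_univ, true_and]
  · obtain ⟨-, hT2⟩ := mem_powersetCard.1 hT
    rw [MulAction.toPerm_apply, prod_mul_distrib, prod_const, hT2, sq, hs, one_mul,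
      show τ • T = T.image τ by ext x; simp only [mem_smul_finset, mem_image, Perm.smul_def],
      prod_image fun x _ y _ hxy => τ.injective hxy]

end TermBlocks

end Summit.ValiantsHypothesis.ValiantsHypothesis.Theorems

end
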